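import Literature.Computability.Cryptography.PeriodFindingClassBallLaw
import Literature.Computability.Cryptography.PeriodFindingTwistedClassSum
import Literature.Computability.Cryptography.PeriodFindingRunTails
import HarnessLib

/-!
# The autocorrelation mass of a shift-cell / coset table: slices, tails, off-ball and ball masses

Topic `Computability/Cryptography` (harmonic analysis of period finding); theorem-only file, no named facts.
Assembles `corrMass_shiftCell` (`PeriodFindingShiftCell.lean`), the twisted-class-sum identity
(`PeriodFindingTwistedClassSum.lean`), the window laws of jittered class sums (`PeriodFindingClassWindowLaw.lean`,
`PeriodFindingClassBallLaw.lean`) and the run-table tails (`PeriodFindingRunTails.lean`) into the mass statements about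
the weight `w(k') = corrMass_{W S a}(F, a k')` of a shift-cell / coset table `F(E + W j) = C_{cls E}((σ_E + j) mod S)`
(`W = M^T`, classes = cosets of `Λ` through the digit vectors, class-disjoint run-shaped cells, integer shifts within
`1` of exact-affine reals) — the idealised table of the class-group stage of `LinnikCubicClassGroups.PureCubicClassGroupFBQP`:

* `corrMass_shiftCell_slice` — `w(k₀ + Sν) = a² ∑_g corrMass_S(C_g, k₀) · |Z_g(ν)|²`, `Z_g` the jittered class sum of
  the class `g` with base angles `k₀/(S M^{T−t}) + kk μ_t` (`kk ≡ k₀ mod S`) and jitter `e(−kk(σ_E − y_E)/S)`;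
* `shiftCell_slice_total` — `∑_ν w(k₀ + Sν) = a² M^T ∑_g #g · corrMass_S(C_g, k₀)`;
* `shiftCell_tail_mass_le` — the residues `k₀` with `K₀ < k₀ < S − K₀` carry `≤ a² M^{2T} · 2 Ncell S²/K₀`;
* `shiftCell_offBall_mass_le` — in the slice `k₀` (`|kk| ≤ K₀`), the frequencies accurate for no dual vector carry
  `≤ a² (∑_g corrMass_S(C_g,k₀)) (M^{2T}/h) κ`, `κ = hB²T/M + ε' + 2(1 + hB²T/M)·2πK₀/S`;
* `shiftCell_ball_mass_le` — in the slice `k₀`, `8h·(mass accurate for ζ₀) ≤ 9·(mass accurate for some ζ)`.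

## References

* S. Hallgren, STOC 2005, §4. [Hallgren2005]
* A. Yu. Kitaev, arXiv:quant-ph/9511026 (1995), §4. [Kitaev1995]
* P. W. Shor, SIAM J. Comput. 26 (1997), §5. [Shor1997]
-/

noncomputable section

namespace Literature.Computability.Cryptography

namespace PeriodFinding

open Complex Finset
open scoped Classical

variable {T : ℕ} {Ω : Type*} [DecidableEq Ω]

section Slice

variable {M S a : ℕ} (hM : 0 < M) (hS : 0 < S) (ha : 0 < a) (cls σ : ℕ → ℕ) (C : ℕ → ℕ → Ω) (y : ℕ → ℝ)
  (μ : Fin T → ℝ)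
  (hC : ∀ E < M ^ T, ∀ E' < M ^ T, ∀ i < S, ∀ i' < S, C (cls E) i = C (cls E') i' → cls E = cls E')
  (hy : ∀ E < M ^ T, ∀ E' < M ^ T, cls E = cls E' → ∃ z : ℤ, y E' - y E + S * ∑ t : Fin T, μ t *
    (((E' / M ^ (t : ℕ) % M : ℕ) : ℝ) - ((E / M ^ (t : ℕ) % M : ℕ) : ℝ)) = S * z)
  (F : ℕ → Ω) (hF : ∀ E < M ^ T, ∀ j < S * a, F (E + M ^ T * j) = C (cls E) ((σ E + j) % S))

include hM hS ha hC hF in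
/-- Off the multiples of `a` the autocorrelation mass of a shift-cell table vanishes. [cite: Hallgren2005, §4] -/
theorem corrMass_shiftCell_eq_zero (c : ℤ) (hc : ¬ (a : ℤ) ∣ c) : corrMass (M ^ T * (S * a)) F c = 0 := by
  rw [corrMass_shiftCell (M ^ T) S a (pow_pos hM T) hS ha cls σ C hC F hF c, if_neg hc]

include hM hS ha hC hy hF in
/-- **The slice identity**: at `c = a(k₀ + Sν)` the autocorrelation mass of a shift-cell / coset table is
`a² ∑_g corrMass_S(C_g, k₀) |Z_g(ν)|²` with the jittered class sums `Z_g` of base angles `k₀/(SM^{T−t}) + kk μ_t`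
(`kk ≡ k₀ mod S`) and jitter `e(−kk(σ_E − y_E)/S)`. [cite: Hallgren2005, §4] -/
theorem corrMass_shiftCell_slice (k₀ ν : ℕ) (kk : ℤ) (hkk : ∃ m : ℤ, (k₀ : ℤ) = kk + S * m) :
    corrMass (M ^ T * (S * a)) F ((a * (k₀ + S * ν) : ℕ) : ℤ) =
      (a : ℝ) ^ 2 * ∑ g ∈ (range (M ^ T)).image cls, corrMass S (C g) k₀ *
        ‖∑ E ∈ (range (M ^ T)).filter (fun E => cls E = g),
          eR (fun t => ((k₀ : ℝ) / ((S : ℝ) * (M : ℝ) ^ (T - (t : ℕ))) + (kk : ℝ) * μ t) + (ν : ℝ) / (M : ℝ) ^ (T - (t : ℕ)))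
            (toZ fun t : Fin T => E / M ^ (t : ℕ) % M) *
          cexp (2 * Real.pi * I * ((-(kk : ℝ) * ((σ E : ℝ) - y E) / S : ℝ) : ℂ))‖ ^ 2 := by
  have hdvd : (a : ℤ) ∣ ((a * (k₀ + S * ν) : ℕ) : ℤ) := ⟨(k₀ + S * ν : ℕ), by push_cast; ring⟩
  have hdiv : ((a * (k₀ + S * ν) : ℕ) : ℤ) / a = ((k₀ + S * ν : ℕ) : ℤ) := by
    push_cast
    rw [show (a : ℤ) * (k₀ + S * ν) / a = (k₀ + S * ν) from Int.mul_ediv_cancel_left _ (by exact_mod_cast ha.ne')]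
  rw [corrMass_shiftCell (M ^ T) S a (pow_pos hM T) hS ha cls σ C hC F hF _, if_pos hdvd, hdiv]
  congr 1
  refine sum_congr rfl fun g hg => ?_
  obtain ⟨E₀, hE₀, rfl⟩ := mem_image.1 hg
  rw [twistedClassSum_norm_eq hM hS ha cls σ y μ hy (mem_range.1 hE₀) k₀ ν kk hkk, mul_comm]
  congr 1
  have hper : ((k₀ + S * ν : ℕ) : ℤ) = (k₀ : ℤ) + S * (ν : ℤ) := by push_cast; ring
  rw [hper, corrMass_add_mul_self S hS]

end Slice

/-! ### Total and tail of a slice -/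

section Mass

variable (hT : 0 < T) {M S a : ℕ} (hM : 0 < M) (hS : 0 < S) (ha : 0 < a) (Λ : AddSubgroup (Fin T → ℤ)) [Λ.FiniteIndex]
  {hB : ℕ} (hhB : Λ.index ≤ hB) (cls σ : ℕ → ℕ) (C : ℕ → ℕ → Ω) (y : ℕ → ℝ) (μ : Fin T → ℝ)
  (hcls : ∀ E < M ^ T, ∀ E' < M ^ T, cls E = cls E' ↔
    (fun t : Fin T => ((E / M ^ (t : ℕ) % M : ℕ) : ℤ) - ((E' / M ^ (t : ℕ) % M : ℕ) : ℤ)) ∈ Λ)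
  (hC : ∀ E < M ^ T, ∀ E' < M ^ T, ∀ i < S, ∀ i' < S, C (cls E) i = C (cls E') i' → cls E = cls E')
  (hσ : ∀ E < M ^ T, |(σ E : ℝ) - y E| ≤ 1)
  (hy : ∀ E < M ^ T, ∀ E' < M ^ T, cls E = cls E' → ∃ z : ℤ, y E' - y E + S * ∑ t : Fin T, μ t *
    (((E' / M ^ (t : ℕ) % M : ℕ) : ℝ) - ((E / M ^ (t : ℕ) % M : ℕ) : ℝ)) = S * z)
  (F : ℕ → Ω) (hF : ∀ E < M ^ T, ∀ j < S * a, F (E + M ^ T * j) = C (cls E) ((σ E + j) % S))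
  {u : ℕ} (hu : 3 ≤ u) (huM : (u : ℝ) / M ≤ 1 / (4 * hB)) {K₀ : ℕ}

include hM hS ha hC hσ hy hF in
/-- **Total mass of a slice**: `∑_{ν<M^T} w(k₀ + Sν) = a² M^T ∑_g #g · corrMass_S(C_g, k₀)`. [cite: Hallgren2005, §4] -/
theorem shiftCell_slice_total (k₀ : ℕ) :
    ∑ ν ∈ range (M ^ T), corrMass (M ^ T * (S * a)) F ((a * (k₀ + S * ν) : ℕ) : ℤ) =
      (a : ℝ) ^ 2 * (M : ℝ) ^ T * ∑ g ∈ (range (M ^ T)).image cls,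
        (((range (M ^ T)).filter (fun E => cls E = g)).card : ℝ) * corrMass S (C g) k₀ := by
  have hkk : ∃ m : ℤ, (k₀ : ℤ) = (k₀ : ℤ) + S * m := ⟨0, by ring⟩
  have hψ : ∀ E < M ^ T,
      ‖cexp (2 * Real.pi * I * ((-((k₀ : ℤ) : ℝ) * ((σ E : ℝ) - y E) / S : ℝ) : ℂ))‖ = 1 ∧
      ‖cexp (2 * Real.pi * I * ((-((k₀ : ℤ) : ℝ) * ((σ E : ℝ) - y E) / S : ℝ) : ℂ)) - 1‖ ≤
        2 * Real.pi * |((k₀ : ℤ) : ℝ)| / S :=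
    fun E hE => norm_jitter_sub_one_le hS k₀ (hσ E hE)
  have hclass : ∀ g ∈ (range (M ^ T)).image cls, ∑ ν ∈ range (M ^ T), corrMass S (C g) k₀ *
      ‖∑ E ∈ (range (M ^ T)).filter (fun E => cls E = g),
          eR (fun t => ((k₀ : ℝ) / ((S : ℝ) * (M : ℝ) ^ (T - (t : ℕ))) + ((k₀ : ℤ) : ℝ) * μ t) +
            (ν : ℝ) / (M : ℝ) ^ (T - (t : ℕ))) (toZ fun t : Fin T => E / M ^ (t : ℕ) % M) *
          cexp (2 * Real.pi * I * ((-((k₀ : ℤ) : ℝ) * ((σ E : ℝ) - y E) / S : ℝ) : ℂ))‖ ^ 2 =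
      (M : ℝ) ^ T * (((range (M ^ T)).filter (fun E => cls E = g)).card : ℝ) * corrMass S (C g) k₀ := by
    intro g hg
    obtain ⟨E₀, hE₀, rfl⟩ := mem_image.1 hg
    rw [← mul_sum, classSum_total hM cls _ _ (fun E hE _ => hψ E hE)]
    ring
  calc ∑ ν ∈ range (M ^ T), corrMass (M ^ T * (S * a)) F ((a * (k₀ + S * ν) : ℕ) : ℤ)
      = ∑ ν ∈ range (M ^ T), (a : ℝ) ^ 2 * ∑ g ∈ (range (M ^ T)).image cls, corrMass S (C g) k₀ *
          ‖∑ E ∈ (range (M ^ T)).filter (fun E => cls E = g),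
            eR (fun t => ((k₀ : ℝ) / ((S : ℝ) * (M : ℝ) ^ (T - (t : ℕ))) + ((k₀ : ℤ) : ℝ) * μ t) +
              (ν : ℝ) / (M : ℝ) ^ (T - (t : ℕ))) (toZ fun t : Fin T => E / M ^ (t : ℕ) % M) *
            cexp (2 * Real.pi * I * ((-((k₀ : ℤ) : ℝ) * ((σ E : ℝ) - y E) / S : ℝ) : ℂ))‖ ^ 2 :=
        sum_congr rfl fun ν _ => corrMass_shiftCell_slice hM hS ha cls σ C y μ hC hy F hF k₀ ν (k₀ : ℤ) hkk
    _ = (a : ℝ) ^ 2 * ∑ g ∈ (range (M ^ T)).image cls, ∑ ν ∈ range (M ^ T), corrMass S (C g) k₀ *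
          ‖∑ E ∈ (range (M ^ T)).filter (fun E => cls E = g),
            eR (fun t => ((k₀ : ℝ) / ((S : ℝ) * (M : ℝ) ^ (T - (t : ℕ))) + ((k₀ : ℤ) : ℝ) * μ t) +
              (ν : ℝ) / (M : ℝ) ^ (T - (t : ℕ))) (toZ fun t : Fin T => E / M ^ (t : ℕ) % M) *
            cexp (2 * Real.pi * I * ((-((k₀ : ℤ) : ℝ) * ((σ E : ℝ) - y E) / S : ℝ) : ℂ))‖ ^ 2 := by
        rw [← mul_sum]
        congr 1
        exact Finset.sum_comm
    _ = (a : ℝ) ^ 2 * ∑ g ∈ (range (M ^ T)).image cls,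
          (M : ℝ) ^ T * (((range (M ^ T)).filter (fun E => cls E = g)).card : ℝ) * corrMass S (C g) k₀ := by
        rw [sum_congr rfl hclass]
    _ = _ := by
        rw [mul_assoc, mul_sum, mul_sum, mul_sum]
        exact sum_congr rfl fun g _ => by ring

include hM hS ha hC hσ hy hF in
/-- **The tail of the circle frequency is light**: with run-shaped cells (fibres = at most two intervals) and at most
`Ncell` cells per class, the residues `K₀ < k₀ < S − K₀` carry total mass `≤ a² M^{2T} · 2 Ncell S² / K₀`.
[cite: Shor1997, §5] [cite: Hallgren2005, §4] -/
theorem shiftCell_tail_mass_le {Ncell : ℕ} (hK₀ : 1 ≤ K₀)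
    (hfib : ∀ E < M ^ T, (∀ ω ∈ (range S).image (C (cls E)), ∃ b₁ b₂ b₁' b₂' : ℕ,
      Disjoint (Ico b₁ b₂) (Ico b₁' b₂') ∧ (range S).filter (fun i => C (cls E) i = ω) = Ico b₁ b₂ ∪ Ico b₁' b₂') ∧
      ((range S).image (C (cls E))).card ≤ Ncell) :
    ∑ k₀ ∈ (range S).filter (fun k₀ => K₀ < k₀ ∧ K₀ < S - k₀), ∑ ν ∈ range (M ^ T),
        corrMass (M ^ T * (S * a)) F ((a * (k₀ + S * ν) : ℕ) : ℤ) ≤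
      (a : ℝ) ^ 2 * (M : ℝ) ^ (2 * T) * (2 * Ncell * (S : ℝ) ^ 2 / K₀) := by
  simp_rw [shiftCell_slice_total hM hS ha cls σ C y μ hC hσ hy F hF]
  rw [← mul_sum, sum_comm]
  have hK₀R : (0 : ℝ) < K₀ := by exact_mod_cast hK₀
  have hclass : ∀ g ∈ (range (M ^ T)).image cls,
      ∑ k₀ ∈ (range S).filter (fun k₀ => K₀ < k₀ ∧ K₀ < S - k₀),
        (((range (M ^ T)).filter (fun E => cls E = g)).card : ℝ) * corrMass S (C g) k₀ ≤
      (((range (M ^ T)).filter (fun E => cls E = g)).card : ℝ) * (2 * Ncell * (S : ℝ) ^ 2 / K₀) := by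
    intro g hg
    obtain ⟨E₀, hE₀, rfl⟩ := mem_image.1 hg
    obtain ⟨hfibE, hN⟩ := hfib E₀ (mem_range.1 hE₀)
    rw [← mul_sum]
    refine mul_le_mul_of_nonneg_left ((sum_corrMass_runTable_tail_le (C (cls E₀)) hfibE hK₀).trans ?_) (by positivity)
    have : (((range S).image (C (cls E₀))).card : ℝ) ≤ Ncell := by exact_mod_cast hN
    rw [div_le_div_iff_of_pos_right hK₀R]
    nlinarith [show (0 : ℝ) ≤ (S : ℝ) ^ 2 by positivity]
  have hsumN : ∑ g ∈ (range (M ^ T)).image cls, (((range (M ^ T)).filter (fun E => cls E = g)).card : ℝ) = (M : ℝ) ^ T := by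
    have h := card_eq_sum_card_fiberwise (s := range (M ^ T)) (t := (range (M ^ T)).image cls) (f := cls)
      fun E hE => mem_image_of_mem cls hE
    rw [card_range] at h
    exact_mod_cast h.symm
  calc (a : ℝ) ^ 2 * (M : ℝ) ^ T * ∑ g ∈ (range (M ^ T)).image cls,
        ∑ k₀ ∈ (range S).filter (fun k₀ => K₀ < k₀ ∧ K₀ < S - k₀),
          (((range (M ^ T)).filter (fun E => cls E = g)).card : ℝ) * corrMass S (C g) k₀
      ≤ (a : ℝ) ^ 2 * (M : ℝ) ^ T * ∑ g ∈ (range (M ^ T)).image cls,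
        (((range (M ^ T)).filter (fun E => cls E = g)).card : ℝ) * (2 * Ncell * (S : ℝ) ^ 2 / K₀) := by
        gcongr with g hg
        exact hclass g hg
    _ = (a : ℝ) ^ 2 * (M : ℝ) ^ (2 * T) * (2 * Ncell * (S : ℝ) ^ 2 / K₀) := by
        rw [← sum_mul, hsumN]; ring

/-! ### Off-ball and ball masses of a slice -/

include hT hM hS ha hhB hcls hC hσ hy hF hu huM in
/-- **Off-ball mass of a slice.** In the slice `k₀` (`kk ≡ k₀ mod S`, `|kk| ≤ K₀`) the frequencies `ν` accurate for NO
dual vector `ζ` of `Λ` (some angle `k₀/(SM^{T−t}) + kk μ_t + ζ_t + ν/M^{T−t}` farther than `2u/M` from `ℤ`) carry mass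
`≤ a² (∑_g corrMass_S(C_g,k₀)) (M^{2T}/h)(α + ε' + 2(1+α)·2πK₀/S)`. [cite: Hallgren2005, §4] -/
theorem shiftCell_offBall_mass_le (k₀ : ℕ) (kk : ℤ) (hkk : ∃ m : ℤ, (k₀ : ℤ) = kk + S * m) (hkkK : |kk| ≤ (K₀ : ℤ)) :
    ∑ ν ∈ (range (M ^ T)).filter (fun ν : ℕ => ¬ ∃ ζ : Fin T → ℚ, ((∀ t, 0 ≤ ζ t ∧ ζ t < 1) ∧
        ∀ v ∈ Λ, ∃ z : ℤ, ∑ t, ζ t * (v t : ℚ) = z) ∧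
        ∀ t : Fin T, |(k₀ : ℝ) / ((S : ℝ) * (M : ℝ) ^ (T - (t : ℕ))) + (kk : ℝ) * μ t + (ζ t : ℝ) +
            (ν : ℝ) / (M : ℝ) ^ (T - (t : ℕ)) -
          round ((k₀ : ℝ) / ((S : ℝ) * (M : ℝ) ^ (T - (t : ℕ))) + (kk : ℝ) * μ t + (ζ t : ℝ) +
            (ν : ℝ) / (M : ℝ) ^ (T - (t : ℕ)))| ≤ 2 * (u : ℝ) / M),
      corrMass (M ^ T * (S * a)) F ((a * (k₀ + S * ν) : ℕ) : ℤ) ≤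
    (a : ℝ) ^ 2 * (∑ g ∈ (range (M ^ T)).image cls, corrMass S (C g) k₀) *
      (((M : ℝ) ^ (2 * T) / Λ.index) * ((hB : ℝ) ^ 2 * T / M + ((T : ℝ) / (u - 2) + 2 * (hB : ℝ) ^ 2 * (2 * u) ^ T / M) +
        2 * (1 + (hB : ℝ) ^ 2 * T / M) * (2 * Real.pi * K₀ / S))) := by
  have hSR : (0 : ℝ) < S := by exact_mod_cast hS
  have hερ : (0 : ℝ) ≤ 2 * Real.pi * K₀ / S := by positivity
  have hkkR : |(kk : ℝ)| ≤ K₀ := by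
    have : ((|kk| : ℤ) : ℝ) ≤ ((K₀ : ℤ) : ℝ) := by exact_mod_cast hkkK
    simpa [Int.cast_abs] using this
  have hψ : ∀ g : ℕ, ∀ E < M ^ T, cls E = g →
      ‖cexp (2 * Real.pi * I * ((-(kk : ℝ) * ((σ E : ℝ) - y E) / S : ℝ) : ℂ))‖ = 1 ∧
      ‖cexp (2 * Real.pi * I * ((-(kk : ℝ) * ((σ E : ℝ) - y E) / S : ℝ) : ℂ)) - 1‖ ≤ 2 * Real.pi * K₀ / S := by
    intro g E hE _
    obtain ⟨h1, h2⟩ := norm_jitter_sub_one_le hS kk (hσ E hE)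
    refine ⟨h1, h2.trans ?_⟩
    rw [mul_div_assoc, mul_div_assoc]
    gcongr
  simp_rw [corrMass_shiftCell_slice hM hS ha cls σ C y μ hC hy F hF k₀ _ kk hkk]
  rw [← mul_sum, Finset.sum_comm, mul_assoc ((a : ℝ) ^ 2)]
  refine mul_le_mul_of_nonneg_left ?_ (by positivity)
  rw [sum_mul]
  refine sum_le_sum fun g hg => ?_
  obtain ⟨E₀, hE₀, rfl⟩ := mem_image.1 hg
  rw [← mul_sum]
  refine mul_le_mul_of_nonneg_left ?_ (corrMass_nonneg _ _ _)
  have h := class_offBall_mass_le hT hM Λ hhB cls hcls (mem_range.1 hE₀)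
    (fun t => (k₀ : ℝ) / ((S : ℝ) * (M : ℝ) ^ (T - (t : ℕ))) + (kk : ℝ) * μ t)
    (fun E => cexp (2 * Real.pi * I * ((-(kk : ℝ) * ((σ E : ℝ) - y E) / S : ℝ) : ℂ))) hερ (hψ (cls E₀)) hu huM
  exact h

include hT hM hS ha hhB hcls hC hσ hy hF hu huM in
/-- **Off-ball mass, summed over the slices.** For a set `Pk` of residues read through signed residues `kk k₀`
(`kk k₀ ≡ k₀ mod S`, `|kk k₀| ≤ K₀`), the total mass of the frequencies accurate for no dual vector is
`≤ a² M^{2T} S² (α + ε' + 2(1+α)·2πK₀/S)` — a fraction `κ` of the total mass `a² M^{2T} S²`. [cite: Hallgren2005, §4] -/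
theorem shiftCell_offBall_mass_sum_le (Pk : Finset ℕ) (hPk : Pk ⊆ range S) (kk : ℕ → ℤ)
    (hkk : ∀ k₀ ∈ Pk, (∃ m : ℤ, (k₀ : ℤ) = kk k₀ + S * m) ∧ |kk k₀| ≤ (K₀ : ℤ)) :
    ∑ k₀ ∈ Pk, ∑ ν ∈ (range (M ^ T)).filter (fun ν : ℕ => ¬ ∃ ζ : Fin T → ℚ, ((∀ t, 0 ≤ ζ t ∧ ζ t < 1) ∧
        ∀ v ∈ Λ, ∃ z : ℤ, ∑ t, ζ t * (v t : ℚ) = z) ∧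
        ∀ t : Fin T, |(k₀ : ℝ) / ((S : ℝ) * (M : ℝ) ^ (T - (t : ℕ))) + (kk k₀ : ℝ) * μ t + (ζ t : ℝ) +
            (ν : ℝ) / (M : ℝ) ^ (T - (t : ℕ)) -
          round ((k₀ : ℝ) / ((S : ℝ) * (M : ℝ) ^ (T - (t : ℕ))) + (kk k₀ : ℝ) * μ t + (ζ t : ℝ) +
            (ν : ℝ) / (M : ℝ) ^ (T - (t : ℕ)))| ≤ 2 * (u : ℝ) / M),
      corrMass (M ^ T * (S * a)) F ((a * (k₀ + S * ν) : ℕ) : ℤ) ≤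
    (a : ℝ) ^ 2 * (M : ℝ) ^ (2 * T) * (S : ℝ) ^ 2 * ((hB : ℝ) ^ 2 * T / M +
      ((T : ℝ) / (u - 2) + 2 * (hB : ℝ) ^ 2 * (2 * u) ^ T / M) + 2 * (1 + (hB : ℝ) ^ 2 * T / M) * (2 * Real.pi * K₀ / S)) := by
  obtain ⟨hMh, -, -⟩ := law_side_conditions hM Λ hhB hu huM
  have hidx : 0 < Λ.index := Nat.pos_of_ne_zero AddSubgroup.FiniteIndex.index_ne_zero
  have hhR : (0 : ℝ) < Λ.index := by exact_mod_cast hidx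
  set κ : ℝ := (hB : ℝ) ^ 2 * T / M + ((T : ℝ) / (u - 2) + 2 * (hB : ℝ) ^ 2 * (2 * u) ^ T / M) +
    2 * (1 + (hB : ℝ) ^ 2 * T / M) * (2 * Real.pi * K₀ / S) with hκ
  have hu2 : (0 : ℝ) < (u : ℝ) - 2 := by
    have : (3 : ℝ) ≤ u := by exact_mod_cast hu
    linarith
  have hκ0 : 0 ≤ κ := by positivity
  -- per slice
  have hslice : ∀ k₀ ∈ Pk, ∑ ν ∈ (range (M ^ T)).filter (fun ν : ℕ => ¬ ∃ ζ : Fin T → ℚ, ((∀ t, 0 ≤ ζ t ∧ ζ t < 1) ∧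
        ∀ v ∈ Λ, ∃ z : ℤ, ∑ t, ζ t * (v t : ℚ) = z) ∧
        ∀ t : Fin T, |(k₀ : ℝ) / ((S : ℝ) * (M : ℝ) ^ (T - (t : ℕ))) + (kk k₀ : ℝ) * μ t + (ζ t : ℝ) +
            (ν : ℝ) / (M : ℝ) ^ (T - (t : ℕ)) -
          round ((k₀ : ℝ) / ((S : ℝ) * (M : ℝ) ^ (T - (t : ℕ))) + (kk k₀ : ℝ) * μ t + (ζ t : ℝ) +
            (ν : ℝ) / (M : ℝ) ^ (T - (t : ℕ)))| ≤ 2 * (u : ℝ) / M),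
      corrMass (M ^ T * (S * a)) F ((a * (k₀ + S * ν) : ℕ) : ℤ) ≤
      (a : ℝ) ^ 2 * (∑ g ∈ (range (M ^ T)).image cls, corrMass S (C g) k₀) * ((M : ℝ) ^ (2 * T) / Λ.index * κ) :=
    fun k₀ hk₀ => shiftCell_offBall_mass_le hT hM hS ha Λ hhB cls σ C y μ hcls hC hσ hy F hF hu huM k₀ (kk k₀)
      (hkk k₀ hk₀).1 (hkk k₀ hk₀).2
  -- total one-dimensional mass of the cells: `∑_{k₀<S} ∑_g corrMass_S(C_g,k₀) = h S²`
  have hcells : ∑ k₀ ∈ Pk, ∑ g ∈ (range (M ^ T)).image cls, corrMass S (C g) k₀ ≤ Λ.index * (S : ℝ) ^ 2 := by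
    calc ∑ k₀ ∈ Pk, ∑ g ∈ (range (M ^ T)).image cls, corrMass S (C g) k₀
        ≤ ∑ k₀ ∈ range S, ∑ g ∈ (range (M ^ T)).image cls, corrMass S (C g) k₀ :=
          sum_le_sum_of_subset_of_nonneg hPk fun _ _ _ => sum_nonneg fun _ _ => corrMass_nonneg _ _ _
      _ = ∑ g ∈ (range (M ^ T)).image cls, ∑ k₀ ∈ range S, corrMass S (C g) k₀ := sum_comm
      _ = ∑ g ∈ (range (M ^ T)).image cls, (S : ℝ) ^ 2 := sum_congr rfl fun g _ => sum_corrMass S hS (C g)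
      _ = Λ.index * (S : ℝ) ^ 2 := by
          rw [sum_const, nsmul_eq_mul, (cosetBoxCount T M Λ hMh cls hcls).1]
  calc _ ≤ ∑ k₀ ∈ Pk, (a : ℝ) ^ 2 * (∑ g ∈ (range (M ^ T)).image cls, corrMass S (C g) k₀) *
        ((M : ℝ) ^ (2 * T) / Λ.index * κ) := sum_le_sum hslice
    _ = (a : ℝ) ^ 2 * ((M : ℝ) ^ (2 * T) / Λ.index * κ) *
        ∑ k₀ ∈ Pk, ∑ g ∈ (range (M ^ T)).image cls, corrMass S (C g) k₀ := by
        rw [mul_sum]; exact sum_congr rfl fun k₀ _ => by ring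
    _ ≤ (a : ℝ) ^ 2 * ((M : ℝ) ^ (2 * T) / Λ.index * κ) * (Λ.index * (S : ℝ) ^ 2) :=
        mul_le_mul_of_nonneg_left hcells (by positivity)
    _ = (a : ℝ) ^ 2 * (M : ℝ) ^ (2 * T) * (S : ℝ) ^ 2 * κ := by field_simp


end Mass

/-- **Ball mass of a slice (near-uniformity of the read dual vector).** In the slice `k₀` (`kk ≡ k₀ mod S`,
`|kk| ≤ K₀`), for every dual vector `ζ₀` of `Λ`: `8h·(mass of the ν accurate for ζ₀) ≤ 9·(mass of the ν accurate for
some ζ)`, provided `8hB²·hBT/M + 8hB(T/(u−2) + 2hB²(2u)^T/M) + 16hB(1+hB²T/M)·2πK₀/S ≤ 1`. [cite: Hallgren2005, §4] -/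
theorem shiftCell_ball_mass_le : ∀ {T : ℕ} {Ω : Type*} [DecidableEq Ω], 0 < T → ∀ {M S a : ℕ}, 0 < M → 0 < S → 0 < a →
    ∀ (Λ : AddSubgroup (Fin T → ℤ)) [Λ.FiniteIndex] {hB : ℕ}, Λ.index ≤ hB →
    ∀ (cls σ : ℕ → ℕ) (C : ℕ → ℕ → Ω) (y : ℕ → ℝ) (μ : Fin T → ℝ),
    (∀ E < M ^ T, ∀ E' < M ^ T, cls E = cls E' ↔
      (fun t : Fin T => ((E / M ^ (t : ℕ) % M : ℕ) : ℤ) - ((E' / M ^ (t : ℕ) % M : ℕ) : ℤ)) ∈ Λ) →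
    (∀ E < M ^ T, ∀ E' < M ^ T, ∀ i < S, ∀ i' < S, C (cls E) i = C (cls E') i' → cls E = cls E') →
    (∀ E < M ^ T, |(σ E : ℝ) - y E| ≤ 1) →
    (∀ E < M ^ T, ∀ E' < M ^ T, cls E = cls E' → ∃ z : ℤ, y E' - y E + S * ∑ t : Fin T, μ t *
      (((E' / M ^ (t : ℕ) % M : ℕ) : ℝ) - ((E / M ^ (t : ℕ) % M : ℕ) : ℝ)) = S * z) →
    ∀ (F : ℕ → Ω), (∀ E < M ^ T, ∀ j < S * a, F (E + M ^ T * j) = C (cls E) ((σ E + j) % S)) →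
    ∀ {u : ℕ}, 3 ≤ u → (u : ℝ) / M ≤ 1 / (4 * hB) → ∀ {K₀ : ℕ} (k₀ : ℕ) (kk : ℤ), (∃ m : ℤ, (k₀ : ℤ) = kk + S * m) →
    |kk| ≤ (K₀ : ℤ) →
    8 * ((hB : ℝ) ^ 3 * T / M) + 8 * (hB * ((T : ℝ) / (u - 2) + 2 * (hB : ℝ) ^ 2 * (2 * u) ^ T / M)) +
      16 * hB * (1 + (hB : ℝ) ^ 2 * T / M) * (2 * Real.pi * K₀ / S) ≤ 1 →
    ∀ (ζ₀ : Fin T → ℚ), (∀ t, 0 ≤ ζ₀ t ∧ ζ₀ t < 1) → (∀ v ∈ Λ, ∃ z : ℤ, ∑ t, ζ₀ t * (v t : ℚ) = z) →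
    8 * (Λ.index : ℝ) * ∑ ν ∈ (range (M ^ T)).filter (fun ν : ℕ =>
        ∀ t : Fin T, |(k₀ : ℝ) / ((S : ℝ) * (M : ℝ) ^ (T - (t : ℕ))) + (kk : ℝ) * μ t + (ζ₀ t : ℝ) +
            (ν : ℝ) / (M : ℝ) ^ (T - (t : ℕ)) -
          round ((k₀ : ℝ) / ((S : ℝ) * (M : ℝ) ^ (T - (t : ℕ))) + (kk : ℝ) * μ t + (ζ₀ t : ℝ) +
            (ν : ℝ) / (M : ℝ) ^ (T - (t : ℕ)))| ≤ 2 * (u : ℝ) / M),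
      corrMass (M ^ T * (S * a)) F ((a * (k₀ + S * ν) : ℕ) : ℤ) ≤
    9 * ∑ ν ∈ (range (M ^ T)).filter (fun ν : ℕ => ∃ ζ : Fin T → ℚ, ((∀ t, 0 ≤ ζ t ∧ ζ t < 1) ∧
        ∀ v ∈ Λ, ∃ z : ℤ, ∑ t, ζ t * (v t : ℚ) = z) ∧
        ∀ t : Fin T, |(k₀ : ℝ) / ((S : ℝ) * (M : ℝ) ^ (T - (t : ℕ))) + (kk : ℝ) * μ t + (ζ t : ℝ) +
            (ν : ℝ) / (M : ℝ) ^ (T - (t : ℕ)) -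
          round ((k₀ : ℝ) / ((S : ℝ) * (M : ℝ) ^ (T - (t : ℕ))) + (kk : ℝ) * μ t + (ζ t : ℝ) +
            (ν : ℝ) / (M : ℝ) ^ (T - (t : ℕ)))| ≤ 2 * (u : ℝ) / M),
      corrMass (M ^ T * (S * a)) F ((a * (k₀ + S * ν) : ℕ) : ℤ) := by
  intro T Ω _ hT M S a hM hS ha Λ _ hB hhB cls σ C y μ hcls hC hσ hy F hF u hu huM K₀ k₀ kk hkk hkkK hnum ζ₀ hζ01 hζint
  have hSR : (0 : ℝ) < S := by exact_mod_cast hS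
  have hερ : (0 : ℝ) ≤ 2 * Real.pi * K₀ / S := by positivity
  have hkkR : |(kk : ℝ)| ≤ K₀ := by
    have : ((|kk| : ℤ) : ℝ) ≤ ((K₀ : ℤ) : ℝ) := by exact_mod_cast hkkK
    simpa [Int.cast_abs] using this
  have hψ : ∀ g : ℕ, ∀ E < M ^ T, cls E = g →
      ‖cexp (2 * Real.pi * I * ((-(kk : ℝ) * ((σ E : ℝ) - y E) / S : ℝ) : ℂ))‖ = 1 ∧
      ‖cexp (2 * Real.pi * I * ((-(kk : ℝ) * ((σ E : ℝ) - y E) / S : ℝ) : ℂ)) - 1‖ ≤ 2 * Real.pi * K₀ / S := by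
    intro g E hE _
    obtain ⟨h1, h2⟩ := norm_jitter_sub_one_le hS kk (hσ E hE)
    refine ⟨h1, h2.trans ?_⟩
    rw [mul_div_assoc, mul_div_assoc]
    gcongr
  simp_rw [corrMass_shiftCell_slice hM hS ha cls σ C y μ hC hy F hF k₀ _ kk hkk]
  rw [← mul_sum, ← mul_sum, Finset.sum_comm, Finset.sum_comm (s := (range (M ^ T)).filter _)]
  simp_rw [← mul_sum]
  rw [show ∀ X : ℝ, 8 * (Λ.index : ℝ) * ((a : ℝ) ^ 2 * X) = (a : ℝ) ^ 2 * (8 * Λ.index * X) from fun X => by ring,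
    show ∀ X : ℝ, 9 * ((a : ℝ) ^ 2 * X) = (a : ℝ) ^ 2 * (9 * X) from fun X => by ring]
  refine mul_le_mul_of_nonneg_left ?_ (by positivity)
  rw [mul_sum, mul_sum]
  refine sum_le_sum fun g hg => ?_
  obtain ⟨E₀, hE₀, rfl⟩ := mem_image.1 hg
  have h := class_ball_mass_le hT hM Λ hhB cls hcls (mem_range.1 hE₀)
    (fun t => (k₀ : ℝ) / ((S : ℝ) * (M : ℝ) ^ (T - (t : ℕ))) + (kk : ℝ) * μ t)
    (fun E => cexp (2 * Real.pi * I * ((-(kk : ℝ) * ((σ E : ℝ) - y E) / S : ℝ) : ℂ))) hερ (hψ (cls E₀)) hu huM hnum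
    ζ₀ hζ01 hζint
  have := mul_le_mul_of_nonneg_left h (corrMass_nonneg S (C (cls E₀)) k₀)
  linarith [this]

end PeriodFinding

end Literature.Computability.Cryptography
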